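import Summits.ResolutionOfSingularities.ResolutionOfSingularities.Theorems.PurelyInseparableDim4StepKitCycle
import Summits.ResolutionOfSingularities.ResolutionOfSingularities.Theorems.PurelyInseparableDim4ZooCertP5m1
import HarnessLib

/-!
# The (γ)-LOOP at `p = q = 5` ‖ K — kernel twin of idea-8 / eng-A's located 2-cycle of the coordinate game
# (cell `res-dim4-pi`, D-0157 DOOR 2, desk WORD 06:22Z brick (E); seat res-dim4-p-13 (g3))

[OURS · counted 0 · a typed fact about OUR coordinate game `CentreBlowup.step`, class (4,1), `p = q = 5`]
Nothing here is a statement about resolution of singularities: resolvability of `z⁵ + P` is untouched (invariants with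
boundary data may well handle this configuration); resolution in dimension `≥ 4` / characteristic `p` is NOT proved.

The configuration (eng-A g3 / idea-8, EV-3(H4) at `p = 5`; the desk re-did the two chart divisions by hand): the
two-term 4-letter polynomial `P = x₁²x₃²(x₃x₄⁷ + x₂⁴) = x₁²x₃³x₄⁷ + x₁²x₂⁴x₃²`.
* EDGE 1 («fibre(+e₄)»): centre `S₁ = V(z,x₁,x₂,x₄)` (indices `{0,1,3}`), chart `x₁`, the FIBRE point `x₄ ↦ x₄ + 1`
  (`b = (0,0,0,1)`, an equimultiple point of the new exceptional hyperplane): the cleaned transform is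
  `Q = x₁⁴x₃³(x₄+1)⁷ + x₁x₂⁴x₃²` (binomials mod 5: coefficients `1,2,1,0,0,1,2,1`).
* At `Q` the permissible coordinate centres are EXACTLY `S₂ = V(z,x₁,x₂,x₃)` (indices `{0,1,2}`, residual order 7
  along it) and the origin — so `S₂` is the UNIQUE inclusion-maximal permissible coordinate centre of `Q`
  (`isPermissibleCentre_Q_iff`): any |max rule must blow up `S₂`.
* EDGE 2 («along(−e₄)»): centre `S₂`, chart `x₁`, the point `x₄ ↦ x₄ − 1` ALONG the centre (`b = (0,0,0,4)`,
  equimultiple): the cleaned transform is `P` VERBATIM.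
With the boundary bookkeeping of `CentreBlowup.step` the recurrent states are `loopP = (P, r = 2e₁, E = {x₁})` and
`loopQ = (Q, r = e₁, E = {x₁})`: `step 5 S₁ x₁ (0,0,0,1) loopP = loopQ` and `step 5 S₂ x₁ (0,0,0,−1) loopQ = loopP` (`gamma_loop`), a
literal 2-CYCLE of `Step2 5` (`gamma_two_cycle`); the bare root `(P, 0, ∅)` enters it in one step (`step2_root`).  At
`P` the permissible coordinate centres are the three lines `{0,1,2}`, `{0,1,3}`, `{1,2,3}` and the origin
(`isPermissibleCentre_P_iff`) — the rule's only freedom is the choice among three maximal lines at `P` (the desk's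
game-value question (iii) is exactly whether another choice escapes).  All checks by `decide` over `ZMod 5` with
res-dim4-p-13's `StepKit` (`step2_of`, `step_eq_iff`, `isEquimultiplePoint_iff`, `isPermissibleCentre_iff`); the
`Fact (Nat.Prime 5)` instance is res-dim4-p-4's (`…ZooCertP5m1`).  OURS; counted 0; AI kernel work, weaker than expert
review.  Supports stmt-ResolutionOfSingularities-16155 (helper).
bears_on: LADDER-RESOLUTION:D157-DOOR2 (res-dim4-pi · (γ)-loop kernel twin · p = 5).
-/

set_option linter.dupNamespace false -- mandated namespace of this single-conjunct summit

-- translated steps over `ZMod 5` exceed the default `decide` unfolding depth (as in `…ZooCertP5m1`)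
set_option maxRecDepth 16384

noncomputable section

namespace Summit.ResolutionOfSingularities.ResolutionOfSingularities.Theorems.PIDim4

namespace GammaLoop

open StepKit
open Literature.AlgebraicGeometry.Resolution
open Literature.AlgebraicGeometry.Resolution.CentreBlowup

/-- The bare root `(P, r = 0, E = ∅)`, `P = x₁²x₃³x₄⁷ + x₁²x₂⁴x₃²`. [folklore] -/
def root : SData 4 (ZMod 5) := ⟨[(![2, 0, 3, 7], 1), (![2, 4, 2, 0], 1)], ![0, 0, 0, 0], ∅⟩

/-- The recurrent state `loopP = (P, r = 2e₁, E = {x₁})`. [folklore] -/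
def loopP : SData 4 (ZMod 5) := ⟨[(![2, 0, 3, 7], 1), (![2, 4, 2, 0], 1)], ![2, 0, 0, 0], {0}⟩

/-- The recurrent state `loopQ = (Q, r = e₁, E = {x₁})`, `Q = x₁⁴x₃³(x₄+1)⁷ + x₁x₂⁴x₃²` expanded mod 5. [folklore] -/
def loopQ : SData 4 (ZMod 5) :=
  ⟨[(![1, 4, 2, 0], 1), (![4, 0, 3, 0], 1), (![4, 0, 3, 1], 2), (![4, 0, 3, 2], 1), (![4, 0, 3, 5], 1),
    (![4, 0, 3, 6], 2), (![4, 0, 3, 7], 1)], ![1, 0, 0, 0], {0}⟩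

/-- Centre of edge 1: `S₁ = V(z, x₁, x₂, x₄)`. [folklore] -/
def S₁ : Finset (Fin 4) := {0, 1, 3}

/-- Centre of edge 2: `S₂ = V(z, x₁, x₂, x₃)`. [folklore] -/
def S₂ : Finset (Fin 4) := {0, 1, 2}

/-- The fibre point of edge 1 (`x₄ ↦ x₄ + 1` in the `x₁`-chart). [folklore] -/
def bFibre : Fin 4 → ZMod 5 := ![0, 0, 0, 1]

/-- The along-the-centre point of edge 2 (`x₄ ↦ x₄ − 1` in the `x₁`-chart). [folklore] -/
def bAlong : Fin 4 → ZMod 5 := ![0, 0, 0, 4]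

/-! ## The two legal edges compose to the identity -/

/-- **The (γ)-loop, literally**: both points are equimultiple, `step 5 S₁ x₁ bFibre loopP = loopQ` and
`step 5 S₂ x₁ bAlong loopQ = loopP`. [folklore] -/
theorem gamma_loop :
    IsEquimultiplePoint 5 S₁ 0 bFibre loopP.toState ∧ step 5 S₁ 0 bFibre loopP.toState = loopQ.toState ∧
      IsEquimultiplePoint 5 S₂ 0 bAlong loopQ.toState ∧ step 5 S₂ 0 bAlong loopQ.toState = loopP.toState :=
  ⟨(isEquimultiplePoint_iff 5 S₁ 0 bFibre loopP).mpr (by decide), (step_eq_iff 5 S₁ 0 bFibre loopP loopQ).mpr (by decide),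
    (isEquimultiplePoint_iff 5 S₂ 0 bAlong loopQ).mpr (by decide), (step_eq_iff 5 S₂ 0 bAlong loopQ loopP).mpr (by decide)⟩

/-- Edge 1 is a legal MODE-2 step (`S₁` Hironaka-permissible, fibre point equimultiple, child non-zero). [folklore] -/
theorem step2_P_Q : Step2 5 loopP.toState loopQ.toState :=
  step2_of S₁ 0 bFibre (by decide) (by decide) (by decide) (by decide) (by decide) (by decide)

/-- Edge 2 is a legal MODE-2 step (`S₂` Hironaka-permissible, along point equimultiple, child non-zero). [folklore] -/
theorem step2_Q_P : Step2 5 loopQ.toState loopP.toState :=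
  step2_of S₂ 0 bAlong (by decide) (by decide) (by decide) (by decide) (by decide) (by decide)

/-- The bare root `(P, 0, ∅)` enters the loop by the same edge 1: `(P, 0, ∅) → loopQ`. [folklore] -/
theorem step2_root : Step2 5 root.toState loopQ.toState :=
  step2_of S₁ 0 bFibre (by decide) (by decide) (by decide) (by decide) (by decide) (by decide)

/-! ## The permissible coordinate centres at `P` and at `Q` -/

/-- **At `Q` the permissible coordinate centres are exactly `S₂` and the origin** — `S₂` is the unique
inclusion-maximal one. [folklore] -/
theorem isPermissibleCentre_Q_iff (S : Finset (Fin 4)) :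
    IsPermissibleCentre 5 S loopQ.toState.F ↔ (S = S₂ ∨ S = Finset.univ) := by
  rw [SData.toState_F, isPermissibleCentre_iff]
  revert S
  decide

/-- **At `P` the permissible coordinate centres are exactly the three lines `{0,1,2}`, `{0,1,3}`, `{1,2,3}` and the
origin** (the same for the bare root, which has the same `F`). [folklore] -/
theorem isPermissibleCentre_P_iff (S : Finset (Fin 4)) :
    IsPermissibleCentre 5 S loopP.toState.F ↔ (S = {0, 1, 2} ∨ S = {0, 1, 3} ∨ S = {1, 2, 3} ∨ S = Finset.univ) := by
  rw [SData.toState_F, isPermissibleCentre_iff]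
  revert S
  decide

/-! ## The infinite MODE-2 play -/

/-- **The (γ)-loop is a literal 2-cycle of `Step2 5`**: the play `loopP, loopQ, loopP, loopQ, …`. [folklore] -/
theorem gamma_two_cycle :
    ∃ c : ℕ → State (ZMod 5), c 0 = loopP.toState ∧ c 1 = loopQ.toState ∧ (∀ k, c (k + 2) = c k) ∧
      ∀ k, Step2 5 (c k) (c (k + 1)) := by
  refine ⟨fun k => if k % 2 = 0 then loopP.toState else loopQ.toState, by simp, by simp, fun k => ?_, fun k => ?_⟩
  · have h : (k + 2) % 2 = k % 2 := by omega
    simp only [h]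
  · rcases Nat.mod_two_eq_zero_or_one k with h | h
    · have h' : (k + 1) % 2 = 1 := by omega
      simp only [h, h', if_true, show (1 : ℕ) ≠ 0 from one_ne_zero, if_false]
      exact step2_P_Q
    · have h' : (k + 1) % 2 = 0 := by omega
      simp only [h, h', if_true, show (1 : ℕ) ≠ 0 from one_ne_zero, if_false]
      exact step2_Q_P

end GammaLoop

end Summit.ResolutionOfSingularities.ResolutionOfSingularities.Theorems.PIDim4
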